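import Summits.ValiantsHypothesis.ValiantsHypothesis.Theorems.GrenetZeonDualUnipotentThreeHalvesLongMassNilSpaceTopImage

/-!
# `GrenetZeon.DualUnipotentThreeHalves` (stmt-ValiantsHypothesis-24318), line `slow_core`, stub (c) `SlowCore.LongMassSlowLawInv`:
# the top images of an IRREDUCIBLE nilpotent space span at least a plane

Sequel of ✓ `NilSpaceTopImage` (p842101 + appends): take `K = ℂ·x₀` in the Reducibility Lemma (✓ `mulVec_top_eq_zero_of_topSpan_le`,
de Seguins Pazzis 2019, Lemma 2.5).  If ALL top images `X^{H−1} y` (`X ∈ V`) of a nilpotent space `V ≤ M_b(ℂ)` of uniform index `≤ H` lie on one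
line `ℂ x₀`, then every non-zero top image `x` satisfies condition (C) («`K ⊆ ℂx + V·x`»), hence `V·x = 0` and `ℂx` is a common invariant line.
So (`not_top_images_on_line_of_irreducible`) an IRREDUCIBLE nilpotent space with `b ≥ 2` and exact index `H` has top images spanning a subspace of
dimension `≥ 2` — dSP's top span `K(V)` is never a line on the habitat of (c) (V34 §2).  Calibration: `Irr(5,5)` (✓ `HeavyTopIrreducibleFive`) has
`K = span{e₁, e₄, e₅}`.

HONEST FRAMING.  Support lemmas (`--supports stmt-ValiantsHypothesis-24318`); NOT progress on (c) (RESEARCH — OPEN); closes no stub; S3, 24318, 8062,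
`VP ≠ VNP` NOT proved.  Def-free, no named facts, no sorry.
[cite: deSeguinsPazzis2019StructuredGerstenhaberII, Lemma 2.5]
-/

set_option linter.dupNamespace false
set_option autoImplicit false

noncomputable section

namespace Summit.ValiantsHypothesis.ValiantsHypothesis.Theorems.GrenetZeon.NilSpaceTopImage

open Matrix
open scoped BigOperators

variable {b : ℕ}

/-! ## Top images on a line

Take `K = ℂ·x₀` in the Reducibility Lemma: if ALL top images `X^{H−1} y` (`X ∈ V`) lie on one line `ℂ x₀` and some
top image is non-zero, then condition (C) holds at it, so `V` kills it — impossible for an irreducible `V` with `b ≥ 2`.  Hence the top images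
of an IRREDUCIBLE nilpotent space of exact uniform index `H` span at least a PLANE (dSP's `K(V)` has dimension `≥ 2`; e.g. `Irr(5,5)`:
`K = span{e₁,e₄,e₅}`). -/

/-- If all top images lie on the line `ℂ x₀`, every point value kills every top image. [cite: deSeguinsPazzis2019StructuredGerstenhaberII, Lemma 2.5] -/
theorem mulVec_top_eq_zero_of_top_images_on_line (V : Submodule ℂ (Matrix (Fin b) (Fin b) ℂ)) {H : ℕ} (hV : ∀ X ∈ V, X ^ H = 0)
    (hH : 1 ≤ H) (x₀ : Fin b → ℂ) (hline : ∀ X ∈ V, ∀ y : Fin b → ℂ, ∃ c : ℂ, X ^ (H - 1) *ᵥ y = c • x₀)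
    {A : Matrix (Fin b) (Fin b) ℂ} (hA : A ∈ V) (y₀ : Fin b → ℂ) (hx : A ^ (H - 1) *ᵥ y₀ ≠ 0) :
    ∀ X ∈ V, X *ᵥ (A ^ (H - 1) *ᵥ y₀) = 0 := by
  obtain ⟨c₀, hc₀⟩ := hline A hA y₀
  have hc₀ne : c₀ ≠ 0 := by
    rintro rfl
    exact hx (by rw [hc₀, zero_smul])
  refine mulVec_top_eq_zero_of_topSpan_le V hV hH (ℂ ∙ x₀) (fun X hX y => ?_) hA y₀ fun w hw => ?_
  · obtain ⟨c, hc⟩ := hline X hX y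
    rw [hc]
    exact Submodule.smul_mem _ c (Submodule.mem_span_singleton_self x₀)
  · obtain ⟨c, rfl⟩ := Submodule.mem_span_singleton.mp hw
    refine ⟨c * c₀⁻¹, 0, V.zero_mem, ?_⟩
    rw [Matrix.zero_mulVec, add_zero, hc₀, smul_smul, mul_assoc, inv_mul_cancel₀ hc₀ne, mul_one]

/-- ★★ **THE TOP IMAGES OF AN IRREDUCIBLE NILPOTENT SPACE SPAN AT LEAST A PLANE.**  If the values of `V` have no common invariant subspace
but `⊥, ⊤`, `b ≥ 2`, and some `A ∈ V` has `A^{H−1} ≠ 0` (exact index), then the top images `X^{H−1} y` (`X ∈ V`) do NOT all lie on one line.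
[cite: deSeguinsPazzis2019StructuredGerstenhaberII, Lemma 2.5] -/
theorem not_top_images_on_line_of_irreducible (V : Submodule ℂ (Matrix (Fin b) (Fin b) ℂ)) {H : ℕ} (hV : ∀ X ∈ V, X ^ H = 0)
    (hH : 1 ≤ H) (hirr : ∀ U : Submodule ℂ (Fin b → ℂ), (∀ X ∈ V, ∀ w ∈ U, X *ᵥ w ∈ U) → U = ⊥ ∨ U = ⊤) (hb : 2 ≤ b)
    {A : Matrix (Fin b) (Fin b) ℂ} (hA : A ∈ V) (y₀ : Fin b → ℂ) (hx : A ^ (H - 1) *ᵥ y₀ ≠ 0) (x₀ : Fin b → ℂ) :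
    ∃ X ∈ V, ∃ y : Fin b → ℂ, ∀ c : ℂ, X ^ (H - 1) *ᵥ y ≠ c • x₀ := by
  by_contra hcon
  push Not at hcon
  have hline : ∀ X ∈ V, ∀ y : Fin b → ℂ, ∃ c : ℂ, X ^ (H - 1) *ᵥ y = c • x₀ := fun X hX y => hcon X hX y
  have h0 := mulVec_top_eq_zero_of_top_images_on_line V hV hH x₀ hline hA y₀ hx
  set x := A ^ (H - 1) *ᵥ y₀ with hxdef
  have hU : ∀ X ∈ V, ∀ w ∈ (ℂ ∙ x), X *ᵥ w ∈ (ℂ ∙ x) := by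
    intro X hX w hw
    obtain ⟨c, rfl⟩ := Submodule.mem_span_singleton.mp hw
    rw [Matrix.mulVec_smul, h0 X hX, smul_zero]
    exact Submodule.zero_mem _
  rcases hirr _ hU with hbot | htop
  · apply hx
    have hmem := Submodule.mem_span_singleton_self (R := ℂ) x
    rw [hbot, Submodule.mem_bot] at hmem
    exact hmem
  · have h1 : Module.finrank ℂ (ℂ ∙ x) = 1 := finrank_span_singleton hx
    rw [htop, finrank_top, Module.finrank_fin_fun] at h1
    omega

end Summit.ValiantsHypothesis.ValiantsHypothesis.Theorems.GrenetZeon.NilSpaceTopImage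

end
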